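import Mathlib
import Summits.Ventures.PercRepro2.Defs
import Summits.Ventures.PercRepro2.Independence
import Summits.Ventures.PercRepro2.Harris
import Summits.Ventures.PercRepro2.Graph
import Summits.Ventures.PercRepro2.Exploration
import Summits.Ventures.PercRepro2.Events
import Summits.Ventures.PercRepro2.FourFunctions
import Summits.Ventures.PercRepro2.Induced
import Summits.Ventures.PercRepro2.Frontier
import Summits.Ventures.PercRepro2.ObsIndependence
import Summits.Ventures.PercRepro2.BHK
import Summits.Ventures.PercRepro2.BHKEvents
import Summits.Ventures.PercRepro2.OrderPreservation
import Summits.Ventures.PercRepro2.BHKAvoid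
import Summits.Ventures.PercRepro2.SameClusterAvoid
import Summits.Ventures.PercRepro2.CaseOneRegime
import Summits.Ventures.PercRepro2.CaseOnePos
import Summits.Ventures.PercRepro2.CaseOneJ11
import Summits.Ventures.PercRepro2.CaseOneRV
import Summits.Ventures.PercRepro2.CaseOnePendant
import Summits.Ventures.PercRepro2.CaseOnePendantAny
import Summits.Ventures.PercRepro2.CaseOnePendantNec
import Summits.Ventures.PercRepro2.HullDefs
import Summits.Ventures.PercRepro2.OneEdge
import Summits.Ventures.PercRepro2.HCov
import Summits.Ventures.PercRepro2.HCovSwap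
import Summits.Ventures.PercRepro2.OddsLemma
import Summits.Ventures.PercRepro2.RV
import Summits.Ventures.PercRepro2.RVBridge
import Summits.Ventures.PercRepro2.CaseOneDWorld
import Summits.Ventures.PercRepro2.CaseOneDWorldPin
import Summits.Ventures.PercRepro2.CaseOneDWorldEdge

/-!
# `(ii)` when every edge at `a₃` goes to a root (blind cell PercRepro2, p1 g14; S5 §2.1 (K7′) in the
kernel, via the D-world)

If every edge at `a₃` joins it to `a₁` or to `a₂` (any multiplicities, any weights), then in the D-world
each such edge can be pinned closed at no cost (`zSplitIID_of_a1_edge`, `zSplitIID_of_a2_edge`), and with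
every edge at `a₃` null the vertex `a₃` is isolated on the support, so all `A`-masses vanish and
`iiExprD = 0` (`iiExprD_eq_zero_of_null`). Induction on the number of non-null edges at `a₃` gives
**`zSplitIID_of_rootsOnly`** and hence **`zSplitII_of_rootsOnly`**: `(ii)` for the root-only class —
K7 (a single `a₁`-edge) and mine-c's two-root class `cd_of_two_root` (restricted to `(ii)`) with
arbitrary multiplicities. Own code; standard axioms.
-/

namespace Summit.Ventures.PercRepro2

namespace CaseOne

section Isolated
variable {V : Type*} {E : Type*} [Fintype E] [DecidableEq E] {R : Type*} [CommRing R]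
variable {ends : E → Sym2 V} {a₃ : V}

omit [Fintype E] [DecidableEq E] in
/-- With every edge at `a₃` closed, nothing but `a₃` is joined to `a₃`. -/
lemma eq_of_conn_closed_at {ω : Config E} (h : ∀ e, a₃ ∈ ends e → ω e = false) {x : V}
    (hc : Conn ends ω a₃ x) : x = a₃ := by
  have hS : ∀ y ∈ ({a₃} : Set V), ∀ z, (openGraph ends ω).Adj y z → z ∈ ({a₃} : Set V) := by
    intro y hy z hyz
    rw [Set.mem_singleton_iff] at hy
    rw [hy] at hyz
    obtain ⟨_, e, he, hends⟩ := openGraph_adj.1 hyz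
    have h3 : a₃ ∈ ends e := by rw [hends]; exact Sym2.mem_mk_left _ _
    rw [h e h3] at he
    exact Bool.noConfusion he
  exact mem_of_conn_of_closed hS (Set.mem_singleton a₃) hc

/-- **If every edge at `a₃` is null, every `A`-mass vanishes**: `P(X ∩ {a₃ ∈ C₁} ∩ Y) = 0`. -/
lemma prob_A_eq_zero_of_null (p : E → R) (hnull : ∀ e, a₃ ∈ ends e → p e = 0) {a₁ : V}
    (h1 : a₁ ≠ a₃) (X Y : Set (Config E)) :
    prob p (X ∩ connEvent ends a₁ a₃ ∩ Y) = 0 := by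
  unfold prob
  refine Finset.sum_eq_zero fun ω _ => ?_
  by_cases hω : ∀ e, a₃ ∈ ends e → ω e = false
  · rw [Set.indicator_of_notMem]
    rintro ⟨⟨_, hc⟩, _⟩
    exact h1 (eq_of_conn_closed_at hω (conn_symm hc))
  · have : ∃ e, a₃ ∈ ends e ∧ ω e = true := by
      by_contra hc
      apply hω
      intro e he
      by_contra hne
      exact hc ⟨e, he, by simpa using hne⟩
    obtain ⟨e, he, hωe⟩ := this
    have hw : weight p ω = 0 := by
      unfold weight
      exact Finset.prod_eq_zero (Finset.mem_univ e) (by simp [edgeFactor, hωe, hnull e he])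
    by_cases hm : ω ∈ X ∩ connEvent ends a₁ a₃ ∩ Y
    · rw [Set.indicator_of_mem hm, hw]
    · rw [Set.indicator_of_notMem hm]

/-- **`iiExprD = 0` when every edge at `a₃` is null.** -/
theorem iiExprD_eq_zero_of_null (p : E → R) (hnull : ∀ e, a₃ ∈ ends e → p e = 0) {o a₁ a₂ b : V}
    (h1 : a₁ ≠ a₃) (c₀ c₁ : R) : iiExprD p ends o a₁ a₂ a₃ b c₀ c₁ = 0 := by
  rw [iiExprD_eq]
  have e1 : connEvent ends a₂ b ∩ connEvent ends a₁ a₃ ∩ connEvent ends a₂ o ∩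
      (connEvent ends a₁ a₂)ᶜ = connEvent ends a₂ b ∩ connEvent ends a₁ a₃ ∩
      (connEvent ends a₂ o ∩ (connEvent ends a₁ a₂)ᶜ) := by rw [Set.inter_assoc]
  have e2 : connEvent ends a₁ a₃ ∩ connEvent ends a₂ o ∩ (connEvent ends a₁ a₂)ᶜ =
      Set.univ ∩ connEvent ends a₁ a₃ ∩ (connEvent ends a₂ o ∩ (connEvent ends a₁ a₂)ᶜ) := by
    rw [Set.univ_inter, Set.inter_assoc]
  have e4 : connEvent ends a₁ a₃ ∩ (connEvent ends a₁ a₂)ᶜ =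
      Set.univ ∩ connEvent ends a₁ a₃ ∩ (connEvent ends a₁ a₂)ᶜ := by rw [Set.univ_inter]
  rw [e1, e2, e4, prob_A_eq_zero_of_null p hnull h1, prob_A_eq_zero_of_null p hnull h1,
    prob_A_eq_zero_of_null p hnull h1, prob_A_eq_zero_of_null p hnull h1]
  ring

end Isolated

section RootsOnly
variable {V : Type*} {E : Type*} [Fintype E] [DecidableEq E] [Fintype V] [DecidableEq V]
  {R : Type*} [Field R] [LinearOrder R] [IsStrictOrderedRing R]
variable {ends : E → Sym2 V} {a₁ a₂ a₃ : V}

/-- The non-null edges at `a₃`. -/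
def liveAt (p : E → R) (ends : E → Sym2 V) (a₃ : V) : Finset E :=
  Finset.univ.filter fun e => a₃ ∈ ends e ∧ p e ≠ 0

omit [Fintype V] [IsStrictOrderedRing R] in
/-- Pinning a live edge removes it from the live set. -/
lemma liveAt_update (p : E → R) (ends : E → Sym2 V) (a₃ : V) (e : E) :
    liveAt (Function.update p e 0) ends a₃ = (liveAt p ends a₃).erase e := by
  ext e'
  simp only [liveAt, Finset.mem_filter, Finset.mem_univ, true_and, Finset.mem_erase, ne_eq]
  by_cases h : e' = e
  · subst h; simp
  · rw [Function.update_of_ne h]; tauto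

/-- **`ZSplitIID` for the root-only class**: if every edge at `a₃` goes to `a₁` or `a₂`
(`o, b ≠ a₃`), then `ZSplitIID`. -/
theorem zSplitIID_of_rootsOnly (p : E → R) (hp : IsProbVec p)
    (hroot : ∀ e, a₃ ∈ ends e → ends e = s(a₁, a₃) ∨ ends e = s(a₂, a₃)) (h1 : a₁ ≠ a₃)
    {o b : V} : ZSplitIID p ends o a₁ a₂ a₃ b := by
  generalize hn : (liveAt p ends a₃).card = n
  induction n using Nat.strong_induction_on generalizing p with
  | _ n ih =>
    by_cases h0 : liveAt p ends a₃ = ∅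
    · -- every edge at `a₃` is null
      have hnull : ∀ e, a₃ ∈ ends e → p e = 0 := by
        intro e he
        by_contra hc
        have : e ∈ liveAt p ends a₃ := by simp [liveAt, he, hc]
        rw [h0] at this
        exact absurd this (Finset.notMem_empty e)
      unfold ZSplitIID
      rw [iiExprD_eq_zero_of_null p hnull h1]
    · obtain ⟨e, he⟩ := Finset.nonempty_iff_ne_empty.mpr h0
      have he' : a₃ ∈ ends e := by
        have := he
        simp only [liveAt, Finset.mem_filter, Finset.mem_univ, true_and] at this
        exact this.1
      have hlt : ((liveAt p ends a₃).erase e).card < n := by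
        rw [← hn]; exact Finset.card_erase_lt_of_mem he
      have hp0 : IsProbVec (Function.update p e 0) := hp.update e le_rfl zero_le_one
      have hrec := ih _ hlt (Function.update p e 0) hp0 (by rw [liveAt_update])
      rcases hroot e he' with h | h
      · exact zSplitIID_of_a1_edge p hp h o b hrec
      · exact zSplitIID_of_a2_edge p hp h o b hrec

/-- **`(ii)` for the root-only class** (K7′ in the kernel): every edge at `a₃` joins a root. -/
theorem zSplitII_of_rootsOnly (p : E → R) (hp : IsProbVec p)
    (hroot : ∀ e, a₃ ∈ ends e → ends e = s(a₁, a₃) ∨ ends e = s(a₂, a₃)) (h1 : a₁ ≠ a₃)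
    (o b : V) : ZSplitII p ends o a₁ a₂ a₃ b :=
  zSplitII_of_dworld p hp ends o a₁ a₂ a₃ b (zSplitIID_of_rootsOnly p hp hroot h1)

/-- **`(RV)` for the root-only class** (when the required-vertex world has mass). -/
theorem rv_of_rootsOnly (p : E → R) (hp : IsProbVec p)
    (hroot : ∀ e, a₃ ∈ ends e → ends e = s(a₁, a₃) ∨ ends e = s(a₂, a₃)) (h1 : a₁ ≠ a₃)
    (o b : V) (hT : 0 < prob p (Tp ends a₁ a₂ a₃)) : RV p ends o a₁ a₂ a₃ b :=
  (rv_iff_ii p ends o a₁ a₂ a₃ b hT).2 (zSplitII_of_rootsOnly p hp hroot h1 o b)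

end RootsOnly

end CaseOne

end Summit.Ventures.PercRepro2
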